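import Mathlib
import Literature.AlgebraicGeometry.Resolution.ExceptionalFibreConnected
import Summits.ResolutionOfSingularities.ResolutionOfSingularities.Theorems.HomologicalConductorNoZenoFullSheafPresentationKernel
import Summits.ResolutionOfSingularities.ResolutionOfSingularities.Theorems.HomologicalConductorNoZenoExtOneExtension
import HarnessLib

/-!
# Crux `NoZenoR` (stmt-ResolutionOfSingularities-19943), line `sandwich-cluster`, G-layer G2 (vii), part 1b:
# every `𝒪_X`-linear form on the presentation kernel `𝒦` extends to `𝒪_X^n` when `Ext¹_T(M, T) = 0`

OURS (cell res-hironaka, chain W4.4; G2 «full-sheaf package» clause (vii) = (W) of the holder's cut,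
res-D-pv-045 AS res-L0-w44-stub-8 `SketchG2Split.lean` v2; seat res-D-pv-024). Nothing of
[claim: Hironaka2017] is used; AI-written, weaker than expert review.

Setting: `T` a Noetherian NORMAL domain, `π : X ⟶ Spec T` a resolution (so `K(X) = Frac T` and
`Γ(X, 𝒪_X) = T`: `isFractionRing_baseToFunctionField`, `IsResolution.isIso_appTop`), `M` a `T`-module
with generators `m : Fin n → M` and `Ext¹_T(M, T) = 0`, `φ : M →+ K(X)^r` injective and `T`-semilinear,
the full sheaf `M~ = 𝒪_X · φ(M)`, its presentation `q : 𝒪_X^n ⟶ M~` (`presentation`, p505917) with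
kernel `𝒦 = ker q`. The (W)-step of Iyama–Wemyss 2.7 (e)⇒(d) / THEOREM Q-rat (B4), sheaf side:

* **`exists_comp_kernel_ι_eq_of_forall_ext_one_eq_zero`** — every `t : 𝒦 ⟶ 𝒪_X` is `κ ≫ ψ` for
  some `ψ : 𝒪_X^n ⟶ 𝒪_X`: the `T`-relations `a ∈ ΩM = ker (T^n ↠ M)` give global sections `Θ a` of `𝒦`;
  `a ↦ t(Θ a) ∈ Γ(X, 𝒪_X) = T` is a `T`-linear form on `ΩM`, which extends to `Λ : T^n → T`
  (`exists_linearMap_comp_subtype_eq_of_forall_ext_one_eq_zero`, stub-1, from `Ext¹(M, T) = 0`);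
  `ψ := ∑ Λ(e_k) pr_k` agrees with `t` on the `Θ a`, hence on `s • x` for every local section `x` of
  `𝒦` (`exists_smul_kernel_section_eq`: `𝒦` is generically generated by the `Θ a`), hence everywhere
  (`Γ(V, 𝒪_X)` is a domain).

References: O. Iyama, M. Wemyss, Math. Z. 265 (2010), Thm. 2.7 [`IyamaWemyss2009`]; M. Artin,
J.-L. Verdier, Math. Ann. 270 (1985), (1.1) [`ArtinVerdier1985`].
-/

-- single-problem summit: the doubled namespace component `ResolutionOfSingularities` is forced
set_option linter.dupNamespace false

noncomputable section

universe u

open CategoryTheory CategoryTheory.Limits AlgebraicGeometry TopologicalSpace Opposite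
open Literature.AlgebraicGeometry.Resolution Literature.AlgebraicGeometry.Morphisms
open Literature.AlgebraicGeometry.Modules

namespace Summit.ResolutionOfSingularities.ResolutionOfSingularities.Theorems.NoZeno.SandwichCluster.FullSheaf

variable {X : Scheme.{u}}

/-! ## (W): forms on the presentation kernel extend to `𝒪_X^n` -/

section Extend

variable [IsIntegral X] {T : Type u} [CommRing T] [IsDomain T] [IsNoetherianRing T]
  [IsIntegrallyClosed T] (π : X ⟶ Spec (.of T))
variable {M : Type u} [AddCommGroup M] [Module T M] {r : ℕ} (φ : M →+ (Fin r → X.functionField))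

omit [IsIntegral X] in
/-- Restriction to `⊤` along `⊤ ≤ ⊤` is the identity on sections of an `𝒪_X`-module. [this work] -/
theorem presheaf_map_le_top_top (N : X.Modules) (y : Γ(N, ⊤)) :
    N.presheaf.map (homOfLE (le_top : (⊤ : X.Opens) ≤ ⊤)).op y = y := by
  have h : (homOfLE (le_top : (⊤ : X.Opens) ≤ ⊤)).op = 𝟙 (op ⊤) := Subsingleton.elim _ _
  rw [h, N.presheaf.map_id]; rfl

omit [IsIntegral X] in
/-- The same for the structure sheaf. [this work] -/
theorem structure_map_le_top_top (g : Γ(X, ⊤)) :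
    X.presheaf.map (homOfLE (le_top : (⊤ : X.Opens) ≤ ⊤)).op g = g := by
  have h : (homOfLE (le_top : (⊤ : X.Opens) ≤ ⊤)).op = 𝟙 (op ⊤) := Subsingleton.elim _ _
  rw [h, X.presheaf.map_id]; rfl

omit [IsIntegral X] in
/-- Restricting the basis section: `(e_k|_⊤)|_V = e_k|_V`. [this work] -/
theorem map_ιFree_app_one (n : ℕ) (k : Fin n) (V : X.Opens) :
    (freeMod X n).presheaf.map (homOfLE (le_top : V ≤ ⊤)).op
        ((show (unitModule X ⟶ freeMod X n) from SheafOfModules.ιFree (ULift.up k)).app ⊤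
          (1 : Γ(X, ⊤))) =
      (show (unitModule X ⟶ freeMod X n) from SheafOfModules.ιFree (ULift.up k)).app V
        (1 : Γ(X, V)) := by
  rw [← Literature.AlgebraicGeometry.Motives.Scheme.Modules.Hom.app_map_apply]
  congr 1
  exact map_one (X.presheaf.map (homOfLE (le_top : V ≤ ⊤)).op).hom

/-- **(W), sheaf form: every `𝒪_X`-linear form on the presentation kernel extends to `𝒪_X^n`.**
Let `T` be a Noetherian normal domain, `π : X ⟶ Spec T` a resolution, `M` a finite `T`-module with
`Ext¹_T(M, T) = 0`, `φ : M →+ K(X)^r` injective and `T`-semilinear, `m : Fin n → M` generators, and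
`q : 𝒪_X^n ⟶ M~ = 𝒪_X · φ(M)` the presentation with kernel `𝒦`. Then every `t : 𝒦 ⟶ 𝒪_X` is the
restriction `κ ≫ ψ` of some `ψ : 𝒪_X^n ⟶ 𝒪_X`. Proof: `T`-relations `a ∈ ΩM = ker (T^n ↠ M)` give
global sections `Θ a` of `𝒦`; `a ↦ t(Θ a) ∈ Γ(X, 𝒪_X) = T` (`IsResolution.isIso_appTop`) is a
`T`-linear form on `ΩM`, which extends to `Λ : T^n → T` (stub-1's
`exists_linearMap_comp_subtype_eq_of_forall_ext_one_eq_zero`, from `Ext¹(M, T) = 0`); `ψ := ∑ Λ(e_k) pr_k`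
agrees with `t` on the `Θ a`, hence — `𝒦` being generically generated by them
(`exists_smul_kernel_section_eq`) and `Γ(V, 𝒪_X)` a domain — everywhere. [this work] -/
theorem exists_comp_kernel_ι_eq_of_forall_ext_one_eq_zero (hπ : IsResolution π)
    (hW : ∀ e : Abelian.Ext (ModuleCat.of T M) (ModuleCat.of T T) 1, e = 0)
    (hφ : ∀ (a : T) (m : M), φ (a • m) = baseToFunctionField π a • φ m)
    (hφinj : Function.Injective φ) {n : ℕ} (m : Fin n → M)
    (hm : Submodule.span T (Set.range m) = ⊤)
    (t : kernel (presentation (X := X) (Fin r → X.functionField) (Set.range φ)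
      (fun k => (⟨φ (m k), m k, rfl⟩ : Set.range φ))) ⟶ unitModule X) :
    ∃ ψ : freeMod X n ⟶ unitModule X,
      kernel.ι (presentation (X := X) (Fin r → X.functionField) (Set.range φ)
        (fun k => (⟨φ (m k), m k, rfl⟩ : Set.range φ))) ≫ ψ = t := by
  haveI : IsDominant π := hπ.isBirational.isDominant
  -- `Γ(X, 𝒪_X) = T`
  haveI := hπ.isIso_appTop
  let eΓ : T ≃+* Γ(X, ⊤) :=
    (Scheme.ΓSpecIso (.of T)).symm.commRingCatIsoToRingEquiv.trans
      (asIso π.appTop).commRingCatIsoToRingEquiv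
  have heΓ : ∀ c : T, eΓ c = algebraMapΓ π c := fun c => rfl
  -- the generators `m` give a surjection `f : T^n ↠ M`
  let f : (Fin n → T) →ₗ[T] M := Fintype.linearCombination T m
  have hf : Function.Surjective f := by
    rw [← LinearMap.range_eq_top, Fintype.range_linearCombination, hm]
  -- notation-free abbreviations for the basis sections and the kernel inclusion
  obtain ⟨e, he⟩ : ∃ e : ∀ V : X.Opens, Fin n → Γ(freeMod X n, V), ∀ V k, e V k =
      (show (unitModule X ⟶ freeMod X n) from SheafOfModules.ιFree (ULift.up k)).app V
        (1 : Γ(X, V)) := ⟨_, fun _ _ => rfl⟩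
  -- `Θ a := ∑ a_k • e_k` over `⊤`, and its kernel lift for a relation `a`
  obtain ⟨θP, hθP⟩ : ∃ θP : (Fin n → T) → Γ(freeMod X n, ⊤), ∀ a, θP a =
      ∑ k, X.presheaf.map (homOfLE (le_top : (⊤ : X.Opens) ≤ ⊤)).op (algebraMapΓ π (a k)) •
        e ⊤ k := ⟨_, fun _ => rfl⟩
  have hθP0 : ∀ a : LinearMap.ker f, (presentation (X := X) (Fin r → X.functionField) (Set.range φ)
      (fun k => (⟨φ (m k), m k, rfl⟩ : Set.range φ))).app ⊤ (θP a) = 0 := fun a => by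
    rw [hθP]
    simp only [he]
    exact presentation_app_sum_eq_zero_of_relation π φ hφ m ⊤ a (LinearMap.mem_ker.mp a.2)
  choose θK hθK using fun a : LinearMap.ker f =>
    exists_kernel_ι_app_eq (presentation (X := X) (Fin r → X.functionField) (Set.range φ)
      (fun k => (⟨φ (m k), m k, rfl⟩ : Set.range φ))) ⊤ (θP a) (hθP0 a)
  have hκinj := kernel_ι_app_injective (presentation (X := X) (Fin r → X.functionField)
      (Set.range φ) (fun k => (⟨φ (m k), m k, rfl⟩ : Set.range φ))) ⊤
  -- `Θ` is additive and `T`-semilinear, hence so is its kernel lift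
  have hθP_add : ∀ a b : Fin n → T, θP (a + b) = θP a + θP b := fun a b => by
    rw [hθP, hθP, hθP, ← Finset.sum_add_distrib]
    refine Finset.sum_congr rfl fun k _ => ?_
    rw [Pi.add_apply, map_add, map_add, add_smul]
  have hθP_smul : ∀ (c : T) (a : Fin n → T), θP (c • a) =
      X.presheaf.map (homOfLE (le_top : (⊤ : X.Opens) ≤ ⊤)).op (algebraMapΓ π c) • θP a := fun c a => by
    rw [hθP, hθP, Finset.smul_sum]
    refine Finset.sum_congr rfl fun k _ => ?_
    rw [Pi.smul_apply, smul_eq_mul, map_mul, map_mul, mul_smul]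
  have hθK_add : ∀ a b : LinearMap.ker f, θK (a + b) = θK a + θK b := fun a b => by
    apply hκinj
    rw [map_add, hθK, hθK, hθK, Submodule.coe_add, hθP_add]
  have hθK_smul : ∀ (c : T) (a : LinearMap.ker f), θK (c • a) =
      X.presheaf.map (homOfLE (le_top : (⊤ : X.Opens) ≤ ⊤)).op (algebraMapΓ π c) • θK a :=
    fun c a => by
    apply hκinj
    rw [Scheme.Modules.Hom.app_smul, hθK, hθK, Submodule.coe_smul, hθP_smul]
  -- the `T`-linear form `a ↦ t(Θ a)` on the syzygy `ΩM = ker f` (values in `Γ(X, 𝒪_X) = T`)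
  obtain ⟨τ, hτ⟩ : ∃ τ : LinearMap.ker f → Γ(X, ⊤), ∀ a,
      τ a = (show Γ(X, ⊤) from t.app ⊤ (θK a)) := ⟨_, fun _ => rfl⟩
  have hτ_add : ∀ a b, τ (a + b) = τ a + τ b := fun a b => by
    rw [hτ, hτ, hτ, hθK_add]
    exact (t.app ⊤).hom.map_add _ _
  have hτ_smul : ∀ (c : T) (a : LinearMap.ker f), τ (c • a) = algebraMapΓ π c * τ a := fun c a => by
    rw [hτ, hτ, hθK_smul, Scheme.Modules.Hom.app_smul, structure_map_le_top_top]
    rfl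
  let lam : LinearMap.ker f →ₗ[T] T :=
    { toFun := fun a => eΓ.symm (τ a)
      map_add' := fun a b => by rw [hτ_add, map_add]
      map_smul' := fun c a => by
        rw [hτ_smul, map_mul, ← heΓ, RingEquiv.symm_apply_apply, RingHom.id_apply, smul_eq_mul] }
  have hlam : ∀ a : LinearMap.ker f, eΓ (lam a) = τ a := fun a => eΓ.apply_symm_apply _
  -- extend it to `T^n` (`Ext¹(M, T) = 0`)
  obtain ⟨Λ, hΛ⟩ := exists_linearMap_comp_subtype_eq_of_forall_ext_one_eq_zero hf hW lam
  have hΛlam : ∀ a : LinearMap.ker f, Λ (a : Fin n → T) = lam a := fun a => by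
    rw [← hΛ]; rfl
  -- the extension `ψ := ∑ Λ(e_k) pr_k : 𝒪_X^n ⟶ 𝒪_X`
  let ψ : freeMod X n ⟶ unitModule X := freeHomOfSections (unitModule X)
    (fun k => (show Γ(unitModule X, ⊤) from algebraMapΓ π (Λ (fun j => if k = j then 1 else 0))))
  have hψtop : ∀ k : Fin n, ψ.app ⊤ (e ⊤ k) =
      (show Γ(unitModule X, ⊤) from algebraMapΓ π (Λ (fun j => if k = j then 1 else 0))) := by
    intro k
    rw [he, ιFree_app_one]
    exact freeHomOfSections_app_top (unitModule X) _ k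
  have hψe : ∀ (V : X.Opens) (k : Fin n), ψ.app V (e V k) =
      (show Γ(unitModule X, V) from
        X.presheaf.map (homOfLE (le_top : V ≤ ⊤)).op
          (algebraMapΓ π (Λ (fun j => if k = j then 1 else 0)))) := by
    intro V k
    rw [he, ← map_ιFree_app_one, Literature.AlgebraicGeometry.Motives.Scheme.Modules.Hom.app_map_apply,
      ← he, hψtop]
    rfl
  -- `ψ` on the `Θ a`: `ψ(Θ a) = Λ(a)` (as a global function)
  have hψθ : ∀ a : Fin n → T, (show Γ(X, ⊤) from ψ.app ⊤ (θP a)) = algebraMapΓ π (Λ a) := by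
    intro a
    rw [hθP, map_sum, LinearMap.pi_apply_eq_sum_univ Λ a, map_sum]
    refine Finset.sum_congr rfl fun k _ => ?_
    rw [Scheme.Modules.Hom.app_smul, hψe, structure_map_le_top_top, structure_map_le_top_top,
      smul_eq_mul, map_mul]
    rfl
  -- injectivity of `T → K(X)`
  have hbTF : Function.Injective (baseToFunctionField π) := by
    letI := (baseToFunctionField π).toAlgebra
    haveI : IsFractionRing T X.functionField :=
      isFractionRing_baseToFunctionField π hπ.isBirational.isIso_stalkMap_genericPoint
    exact IsFractionRing.injective T X.functionField
  refine ⟨ψ, ?_⟩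
  -- compare `κ ≫ ψ` and `t` on sections over every open `V`
  apply Scheme.Modules.hom_ext
  intro V
  ext x
  change (show Γ(X, V) from ψ.app V ((kernel.ι (presentation (X := X) (Fin r → X.functionField) (Set.range φ)
      (fun k => (⟨φ (m k), m k, rfl⟩ : Set.range φ)))).app V x)) = (show Γ(X, V) from t.app V x)
  rcases isEmpty_or_nonempty V with hV | hV
  · -- no sections over the empty open
    have hbot : V = ⊥ := by
      ext y; exact ⟨fun hy => (hV.false ⟨y, hy⟩).elim, fun hy => hy.elim⟩
    haveI : Subsingleton Γ(X, V) :=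
      CommRingCat.subsingleton_of_isTerminal (X.sheaf.isTerminalOfEqEmpty hbot)
    exact Subsingleton.elim _ _
  · haveI := hV
    obtain ⟨y₀⟩ := hV
    obtain ⟨s, hs, a, ha, hsa⟩ := exists_smul_kernel_section_eq π φ hπ hφ hφinj m V x
    have hamem : a ∈ LinearMap.ker f := LinearMap.mem_ker.mpr ha
    -- `s|_V • x = (θK a)|_V`
    have hres :
        X.presheaf.map (homOfLE (le_top : V ≤ ⊤)).op (algebraMapΓ π s) • x =
          (kernel (presentation (X := X) (Fin r → X.functionField) (Set.range φ)
            (fun k => (⟨φ (m k), m k, rfl⟩ : Set.range φ)))).presheaf.map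
              (homOfLE (le_top : V ≤ ⊤)).op (θK ⟨a, hamem⟩) := by
      apply kernel_ι_app_injective _ V
      rw [Scheme.Modules.Hom.app_smul, hsa,
        Literature.AlgebraicGeometry.Motives.Scheme.Modules.Hom.app_map_apply, hθK, hθP, map_sum]
      refine Finset.sum_congr rfl fun k _ => ?_
      rw [Scheme.Modules.map_smul, he ⊤ k, map_ιFree_app_one, ← he, ← CategoryTheory.comp_apply,
        ← X.presheaf.map_comp]
      rfl
    -- `s|_V ≠ 0` in the domain `Γ(V, 𝒪_X)`
    obtain ⟨sV, hsV_def⟩ : ∃ sV : Γ(X, V),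
        sV = X.presheaf.map (homOfLE (le_top : V ≤ ⊤)).op (algebraMapΓ π s) := ⟨_, rfl⟩
    have hsV : sV ≠ 0 := by
      intro h0
      apply hs
      apply hbTF
      rw [map_zero, ← evalFn_res_algebraMapΓ (X := X) π V y₀ s, ← hsV_def, h0, map_zero]
    rw [← hsV_def] at hres
    -- the difference `D z := ψ(κ z) - t z` in `Γ(V, 𝒪_X)`
    obtain ⟨D, hD⟩ : ∃ D : Γ(kernel (presentation (X := X) (Fin r → X.functionField) (Set.range φ)
      (fun k => (⟨φ (m k), m k, rfl⟩ : Set.range φ))), V) → Γ(X, V), ∀ z,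
        D z = (show Γ(X, V) from ψ.app V ((kernel.ι (presentation (X := X) (Fin r → X.functionField) (Set.range φ)
      (fun k => (⟨φ (m k), m k, rfl⟩ : Set.range φ)))).app V z)) -
          (show Γ(X, V) from t.app V z) := ⟨_, fun _ => rfl⟩
    have hD_smul : ∀ z, D (sV • z) = sV * D z := fun z => by
      rw [hD, hD, Scheme.Modules.Hom.app_smul, Scheme.Modules.Hom.app_smul,
        Scheme.Modules.Hom.app_smul, mul_sub]
      rfl
    have h1 : (show Γ(X, ⊤) from ψ.app ⊤ ((kernel.ι (presentation (X := X) (Fin r → X.functionField) (Set.range φ)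
      (fun k => (⟨φ (m k), m k, rfl⟩ : Set.range φ)))).app ⊤ (θK ⟨a, hamem⟩))) =
        algebraMapΓ π (Λ a) := by
      rw [hθK]; exact hψθ a
    have h2 : (show Γ(X, ⊤) from t.app ⊤ (θK ⟨a, hamem⟩)) = algebraMapΓ π (Λ a) := by
      rw [← hτ, ← hlam, heΓ, ← hΛlam]
    have hD_res : D ((kernel (presentation (X := X) (Fin r → X.functionField) (Set.range φ)
      (fun k => (⟨φ (m k), m k, rfl⟩ : Set.range φ)))).presheaf.map (homOfLE (le_top : V ≤ ⊤)).op (θK ⟨a, hamem⟩)) = 0 := by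
      rw [hD, Literature.AlgebraicGeometry.Motives.Scheme.Modules.Hom.app_map_apply (kernel.ι _),
        Literature.AlgebraicGeometry.Motives.Scheme.Modules.Hom.app_map_apply ψ,
        Literature.AlgebraicGeometry.Motives.Scheme.Modules.Hom.app_map_apply t]
      change X.presheaf.map (homOfLE (le_top : V ≤ ⊤)).op
          (show Γ(X, ⊤) from ψ.app ⊤ ((kernel.ι (presentation (X := X) (Fin r → X.functionField) (Set.range φ)
      (fun k => (⟨φ (m k), m k, rfl⟩ : Set.range φ)))).app ⊤ (θK ⟨a, hamem⟩))) -
        X.presheaf.map (homOfLE (le_top : V ≤ ⊤)).op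
          (show Γ(X, ⊤) from t.app ⊤ (θK ⟨a, hamem⟩)) = 0
      rw [h1, h2, sub_self]
    have key : sV * D x = 0 := by rw [← hD_smul, hres, hD_res]
    have hDx : D x = 0 := (mul_eq_zero.mp key).resolve_left hsV
    rw [hD] at hDx
    exact sub_eq_zero.mp hDx

end Extend

end Summit.ResolutionOfSingularities.ResolutionOfSingularities.Theorems.NoZeno.SandwichCluster.FullSheaf

end
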